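import Summits.BirchSwinnertonDyer.BirchSwinnertonDyer.Theorems.AlignedTransportAtTwoMainConjectureOfRankZeroBSDAtTwoHalfDescentLayerIndexFinite
import Summits.BirchSwinnertonDyer.BirchSwinnertonDyer.Theorems.AlignedTransportAtTwoMainConjectureOfRankZeroBSDAtTwoHalfDescentLayerIndexSelmer
import Summits.BirchSwinnertonDyer.BirchSwinnertonDyer.Theorems.AlignedTransportAtTwoMainConjectureOfRankZeroBSDAtTwoHalfDescentHighGrowthAnyPrime
import HarnessLib

/-!
# Route `AlignedTransportAtTwo`, crux C2 `MainConjectureOfRankZeroBSDAtTwo` (stmt-BirchSwinnertonDyer-22298):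
# THE DESCENT NUMBER WITHOUT GREENBERG 4.14, II — SELMER CURRENCY AND THE DATUM: for ANY Pontryagin-dual datum with `X` finitely generated torsion,
# `#ker(N_n | Sel_{p^∞}(E/K_∞)) = p^{φ(p^{n+1})μ + λ} · #(F/Ψ_n F)` (`F` the largest finite submodule of `X`); hence `p^{φμ+λ} ∣ #ker N_n`, equality iff
# `X` has no finite submodule, and — Kato 17.4 only, NO Prop. 4.14 binder — `#ker N_n < p^{φ(p^{n+1})}` at ONE layer with `φ > λ_an` ⟹ `μ(X) = 0`

HONEST FRAMING (cell `bsd-f1-sign2`, WIDTH-5 attached prover seat `bsd-line-att-p5` gen 55 on line `birth` of the lead `bsd-line-att-p2`;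
`--supports` stmt-BirchSwinnertonDyer-22298, closes nothing; BSD is NOT proved by any of this; the crux C2, its verdict «blocked-on
`Rank1Residual.GreenbergMuConjectureIrreducible`» and every registered stub (P / T / Kμ / LimDoor / MuIneqʳ / PFμ⁺) are untouched). THEOREMS ONLY — no `def`,
no instance, no `sorry`; ONE PRINT binder (`h17` = Kato's Thm. 17.4 (1)(2), the lineage's `kato_divisibility_allPrimes`) in §2 only. Sequel of
`…HalfDescentLayerIndexFinite` (this gen: `#(X/Ψ_nX) = p^{φμ+λ}·#(F/Ψ_nF)` for ANY f.g. torsion `X`; `μ = 0 ⟸ #(X/Ψ_nX) < p^{φ}`) composed with g54's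
`…HalfDescentLayerIndexSelmer` (`#(X/Ψ_nX) = #ker(N_n | Sel_∞)`, g40's Pontryagin pair at `(Ψ_n, N_n)`) and g53's `…HalfDescentHighGrowthAnyPrime`
(`charGen_dvd_C_pow_mul_lift`: Kato ⟹ `f_X ∣ p^m·G`, so `λ(f_X) ≤ λ(G)`). g54's `…HalfDescentLayerIndexSelmerDatum` needs the DISPLAYED binder `hnf` (Greenberg 4.14,
or `prop414` by name) and an EXACT count; here the `μ`-half needs NEITHER: finite submodules are allowed and an UPPER BOUND suffices.

* §1 (any number field `K`, any `ℤ_p`-extension `κ`, topological generator `γ`, dual datum `D` with `X` f.g. torsion — finite submodules ALLOWED; `char_Λ X = (f)`)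
  ★★★ **`natCard_endInvariants_relNorm_eq_pow_mul`: `#ker(N_n | Sel_{p^∞}(E/K_∞)) = p^{pⁿ(p−1)·μ(f) + λ(f)} · #(F/Ψ_n F)`** at every `n` with `λ(f) < pⁿ(p−1)`
  (`N_n = ∑_{i<p}(conj_γ^{pⁿ})^i`, `F ≤ X` finite with `X/F` free of finite submodules); ★★ `pow_dvd_natCard_endInvariants_relNorm`; ★★
  `natCard_endInvariants_relNorm_eq_pow_iff` (**`= p^{φμ+λ} ⟺ X` has no non-zero finite submodule** — one relative-norm kernel detects Prop. 4.14);
  ★★★ **`mu_eq_zero_of_natCard_endInvariants_relNorm_lt`: `#ker N_n < p^{pⁿ(p−1)}` ⟹ `μ(f) = 0` and `μ(X) = 0`** (`D.mu = 0`).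
* §2 (`K = ℚ`, cyclotomic, `W` globally minimal ordinary at `p`, `f` a newform of `W`, `G ≠ 0` an integral lift of `L_p(f, α)`, PRINT `h17`; NO `hnf`)
  ★★★ **`mu_eq_zero_of_kato_of_natCard_endInvariants_relNorm_lt`: `λ(G) < pⁿ(p−1)` and `#ker(N_n | Sel_{p^∞}(W/ℚ_∞)) < p^{pⁿ(p−1)}` ⟹ `μ(f_X) = 0 ∧ μ(X) = 0`**;
  `p = 2`: ★★★ **`mu_eq_zero_of_kato_of_natCard_endInvariants_relNorm_lt_two`: `λ(G) < 2ⁿ` and `#ker N_n < 2^{2ⁿ}` ⟹ `μ₂(X(W/ℚ_∞)) = 0`** — the residue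
  «`μ_alg = 0`» of C2 for the seed from ONE UPPER BOUND on ONE relative-norm kernel, with no Greenberg 4.14/4.15 input (the sequel `…HalfDescentLayerIndexCertificate`
  removes the `λ`-bookkeeping as well and composes with the seed `…Seed.mazurMainConjecture_two_of_bsdp_of_mu_eq_zero`).
Memo `Cruxes/MainConjectureOfRankZeroBSDAtTwo/LAYER-INDEX-FINITE-att-p5-g55.md`. BSD is not proved by any of this; nothing about any curve's BSD₂ is asserted here.

References: R. Greenberg, LNM 1716 (1999), §1 pp. 60–65, Conj. 1.11, §4 p. 117, Prop. 4.14–4.15 [GreenbergLNM1716]; L. Washington, GTM 83, §13.3 Thm. 13.13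
[Washington1997]; K. Kato, Astérisque 295 (2004) Thm. 17.4 [Kato2004Asterisque]; J. Neukirch, A. Schmidt, K. Wingberg, (5.3.1), (5.3.17) [NeukirchSchmidtWingberg2008].
-/

set_option linter.dupNamespace false
set_option autoImplicit false

noncomputable section

open scoped Classical AddSubgroup MatrixGroups ModularForm Polynomial

universe u

namespace Summit.BirchSwinnertonDyer.BirchSwinnertonDyer.Theorems.AlignedTransportAtTwoHalfDescentLayerIndexFiniteSelmer

open CongruenceSubgroup WeierstrassCurve Literature.NumberTheory.EllipticCurves Literature.NumberTheory.EllipticCurves.IwasawaDual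
  Literature.NumberTheory.EllipticCurves.IwasawaAlgebra
  Literature.NumberTheory.EllipticCurves.ModularForms
  Literature.NumberTheory.EllipticCurves.Rank1Residual
  Summit.BirchSwinnertonDyer.Rank1Residual
  Summit.BirchSwinnertonDyer.Rank1Residual.X1.MuLambda
  Summit.BirchSwinnertonDyer.Rank1Residual.X1.GeneratorBoundMu
  Summit.BirchSwinnertonDyer.Rank1Residual.Iwasawa
  Summit.BirchSwinnertonDyer.BirchSwinnertonDyer.Theorems.DefectPrime
  Summit.BirchSwinnertonDyer.BirchSwinnertonDyer.Theorems.AlignedTransportAtTwoCyclotomicLayerPrime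
  Summit.BirchSwinnertonDyer.BirchSwinnertonDyer.Theorems.AlignedTransportAtTwoHalfDescentKato
  Summit.BirchSwinnertonDyer.BirchSwinnertonDyer.Theorems.AlignedTransportAtTwoHalfDescentHighGrowthAnyPrime
  Summit.BirchSwinnertonDyer.BirchSwinnertonDyer.Theorems.AlignedTransportAtTwoHalfDescentLayerIndexSelmer
  Summit.BirchSwinnertonDyer.BirchSwinnertonDyer.Theorems.AlignedTransportAtTwoHalfDescentLayerIndexFinite

/-! ## §1 Selmer currency, any `ℤ_p`-extension: `#ker N_n = p^{φμ+λ} · #(F/Ψ_n F)`; `#ker N_n < p^{φ} ⟹ μ = 0` -/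

section Selmer

variable {K : Type u} [Field K] [NumberField K] (W : WeierstrassCurve K) {p : ℕ} [hp : Fact p.Prime] (κ : ZpExtension K p)
  {γ : Field.absoluteGaloisGroup K}

/-- ★★★ **THE KERNEL OF THE RELATIVE NORM FOR A GENERAL DUAL DATUM.** `E/K`, `κ` any `ℤ_p`-extension with topological generator `γ`, `D` a Pontryagin-dual
datum whose `X` is finitely generated torsion (finite submodules ALLOWED), `char_Λ X = (f)`, `F ≤ X` finite with `X/F` free of finite submodules. Then at every
layer `n` with `λ(f) < pⁿ(p−1)`: **`#{s ∈ Sel_{p^∞}(E/K_∞) : N_n s = 0} = p^{pⁿ(p−1)·μ(f) + λ(f)} · #(F/Ψ_n F)`**, `N_n = ∑_{i<p}(conj_γ^{pⁿ})^i`.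
[cite: GreenbergLNM1716, §1 pp. 60–65 and §4 p. 117] [cite: Washington1997, §13.3 Thm. 13.13] [cite: NeukirchSchmidtWingberg2008, (5.3.17)] -/
theorem natCard_endInvariants_relNorm_eq_pow_mul (hγ : κ.IsTopGenerator γ) (D : W.SelmerDualData κ γ) [Module.Finite (IwasawaAlgebra p) D.X]
    (hD : D.IsTorsion) (F : Submodule (IwasawaAlgebra p) D.X) [Finite F] (hF : ∀ N' : Submodule (IwasawaAlgebra p) (D.X ⧸ F), Finite N' → N' = ⊥)
    {f : IwasawaAlgebra p} (hchar : D.charIdeal = Ideal.span {f}) {n : ℕ} (hlam : lam f < p ^ n * (p - 1)) :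
    Nat.card ↥(endInvariants (∑ i ∈ Finset.range p, ((W.conjSelmerInfty κ γ) ^ (p ^ n)) ^ i)) =
      p ^ (p ^ n * (p - 1) * mu f + lam f) *
        Nat.card (F ⧸ (Ideal.span {(((Polynomial.cyclotomic (p ^ (n + 1)) ℤ_[p]).comp (Polynomial.X + 1) : ℤ_[p][X]) : IwasawaAlgebra p)} • ⊤ :
          Submodule (IwasawaAlgebra p) F)) := by
  rw [← natCard_layerQuotient_cyclotomic_eq_natCard_endInvariants W κ hγ D n]
  exact natCard_layerQuotient_eq_pow_mul (M := D.X) hD F hF hchar hlam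

/-- ★★ **`p^{pⁿ(p−1)·μ(f) + λ(f)} ∣ #ker(N_n | Sel_{p^∞}(E/K_∞))`** for EVERY dual datum with `X` f.g. torsion, `char_Λ X = (f)`, `λ(f) < pⁿ(p−1)`; and the kernel is
finite (non-zero `Nat.card`). [cite: GreenbergLNM1716, §1 pp. 60–65] [cite: Washington1997, §13.3 Thm. 13.13] -/
theorem pow_dvd_natCard_endInvariants_relNorm (hγ : κ.IsTopGenerator γ) (D : W.SelmerDualData κ γ) [Module.Finite (IwasawaAlgebra p) D.X]
    (hD : D.IsTorsion) {f : IwasawaAlgebra p} (hchar : D.charIdeal = Ideal.span {f}) {n : ℕ} (hlam : lam f < p ^ n * (p - 1)) :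
    p ^ (p ^ n * (p - 1) * mu f + lam f) ∣ Nat.card ↥(endInvariants (∑ i ∈ Finset.range p, ((W.conjSelmerInfty κ γ) ^ (p ^ n)) ^ i)) ∧
    0 < Nat.card ↥(endInvariants (∑ i ∈ Finset.range p, ((W.conjSelmerInfty κ γ) ^ (p ^ n)) ^ i)) := by
  rw [← natCard_layerQuotient_cyclotomic_eq_natCard_endInvariants W κ hγ D n]
  obtain ⟨hdvd, hfin⟩ := pow_dvd_natCard_layerQuotient (M := D.X) hD hchar hlam
  exact ⟨hdvd, Nat.card_pos⟩

/-- ★★ **ONE RELATIVE-NORM KERNEL DETECTS GREENBERG'S PROP. 4.14 CONDITION: `#ker N_n = p^{pⁿ(p−1)·μ(f) + λ(f)} ⟺ X` has no non-zero finite submodule**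
(dual datum with `X` f.g. torsion, `char_Λ X = (f)`, `λ(f) < pⁿ(p−1)`). [cite: GreenbergLNM1716, Prop. 4.14–4.15] [cite: Washington1997, §13.3 Thm. 13.13] -/
theorem natCard_endInvariants_relNorm_eq_pow_iff (hγ : κ.IsTopGenerator γ) (D : W.SelmerDualData κ γ) [Module.Finite (IwasawaAlgebra p) D.X]
    (hD : D.IsTorsion) {f : IwasawaAlgebra p} (hchar : D.charIdeal = Ideal.span {f}) {n : ℕ} (hlam : lam f < p ^ n * (p - 1)) :
    Nat.card ↥(endInvariants (∑ i ∈ Finset.range p, ((W.conjSelmerInfty κ γ) ^ (p ^ n)) ^ i)) = p ^ (p ^ n * (p - 1) * mu f + lam f) ↔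
      ∀ N' : Submodule (IwasawaAlgebra p) D.X, Finite N' → N' = ⊥ := by
  rw [← natCard_layerQuotient_cyclotomic_eq_natCard_endInvariants W κ hγ D n]
  exact natCard_layerQuotient_eq_pow_iff (M := D.X) hD hchar hlam

/-- ★★★ **GREENBERG'S `μ = 0` FROM ONE UPPER BOUND ON ONE RELATIVE-NORM KERNEL.** `E/K`, `κ`, `γ`, `D` as above (`X` f.g. torsion, finite submodules allowed,
`char_Λ X = (f)`). If at ONE layer `n` with `λ(f) < pⁿ(p−1)`: **`#ker(N_n | Sel_{p^∞}(E/K_∞)) < p^{pⁿ(p−1)}`**, then **`μ(f) = 0` and `μ(X(E/K_∞)) = 0`**. No exact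
count, no hypothesis on finite submodules. [cite: GreenbergLNM1716, Conj. 1.11 and §1 pp. 60–65] [cite: Washington1997, §13.3 Thm. 13.13] -/
theorem mu_eq_zero_of_natCard_endInvariants_relNorm_lt (hγ : κ.IsTopGenerator γ) (D : W.SelmerDualData κ γ) [Module.Finite (IwasawaAlgebra p) D.X]
    (hD : D.IsTorsion) {f : IwasawaAlgebra p} (hchar : D.charIdeal = Ideal.span {f}) {n : ℕ} (hlam : lam f < p ^ n * (p - 1))
    (hlt : Nat.card ↥(endInvariants (∑ i ∈ Finset.range p, ((W.conjSelmerInfty κ γ) ^ (p ^ n)) ^ i)) < p ^ (p ^ n * (p - 1))) :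
    mu f = 0 ∧ D.mu = 0 := by
  rw [← natCard_layerQuotient_cyclotomic_eq_natCard_endInvariants W κ hγ D n] at hlt
  exact ⟨mu_eq_zero_of_natCard_layerQuotient_lt (M := D.X) hD hchar hlam hlt, muInvariant_eq_zero_of_natCard_layerQuotient_lt (M := D.X) hD hchar hlam hlt⟩

end Selmer

/-! ## §2 The datum (Kato 17.4 only, NO Prop. 4.14 binder): `#ker N_n < p^{φ}` at one layer with `φ > λ_an` ⟹ `μ(X) = 0` -/

section Datum

variable (W : WeierstrassCurve ℚ) [W.IsGloballyMinimal] (p : ℕ) [hp : Fact p.Prime]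

/-- ★★★ **`μ = 0` AT THE DATUM FROM ONE UPPER BOUND (any `p`).** `W/ℚ` globally minimal, ordinary at `p`; `f` a newform of `W`, `G ≠ 0` an integral lift of
`L_p(f, α)`; PRINT `h17` = Kato's Thm. 17.4 (1)(2) at `p`; a cyclotomic dual datum `D` with `X` finitely generated (finite submodules ALLOWED — no Greenberg 4.14
binder) and `char_Λ X = (f_X)`, `f_X ≠ 0`. If at ONE layer `n` with **`λ(G) < pⁿ(p−1)`** the relative-norm kernel satisfies
**`#ker(N_n | Sel_{p^∞}(W/ℚ_∞)) < p^{pⁿ(p−1)}`**, then **`μ(f_X) = 0` and `μ(X(W/ℚ_∞)) = 0`** (Kato gives `λ(f_X) ≤ λ(G)`, so the layer is high for `f_X`).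
[cite: Kato2004Asterisque, Thm. 17.4 (1)(2) (p. 273)] [cite: GreenbergLNM1716, Conj. 1.11] [cite: Washington1997, §13.3 Thm. 13.13] -/
theorem mu_eq_zero_of_kato_of_natCard_endInvariants_relNorm_lt {N : ℕ} [NeZero N] {f : CuspForm (Gamma0 N) 2}
    (h17 : kato_divisibility_allPrimes W p (f := f)) {κ : ZpExtension ℚ p} {γ : Field.absoluteGaloisGroup ℚ}
    (hκ : κ.IsCyclotomic) (hγ : κ.IsTopGenerator γ) (hγ' : IsCyclotomicVariable p γ) (hord : IsOrdinaryAt W p) (hf : IsNewformOf W f)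
    (D : W.SelmerDualData κ γ) [Module.Finite (IwasawaAlgebra p) D.X]
    {fX : IwasawaAlgebra p} (hfX : fX ≠ 0) (hchar : D.charIdeal = Ideal.span {fX}) {G : IwasawaAlgebra p} (hG0 : G ≠ 0)
    (hG : iwasawaToPowerSeries p G = padicLFunction f (unitRoot W p : ℚ_[p])) {n : ℕ} (hhigh : lam G < p ^ n * (p - 1))
    (hlt : Nat.card ↥(endInvariants (∑ i ∈ Finset.range p, ((W.conjSelmerInfty κ γ) ^ (p ^ n)) ^ i)) < p ^ (p ^ n * (p - 1))) :
    mu fX = 0 ∧ D.mu = 0 := by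
  obtain ⟨hD, m, hdvd⟩ := charGen_dvd_C_pow_mul_lift W p h17 hκ hγ hγ' hord hf D hchar hG
  -- `λ(f_X) ≤ λ(G)`: the layer is high for `f_X` too
  have hP := weierstrassDistinguished_pfree_dvd_of_dvd_C_pow_mul hfX hG0 hdvd
  have hlamle : lam fX ≤ lam G := by
    rw [lam_eq_natDegree_weierstrassDistinguished (eq_C_pow_mu_mul_pfree fX) (red_pfree_ne_zero hfX),
      lam_eq_natDegree_weierstrassDistinguished (eq_C_pow_mu_mul_pfree G) (red_pfree_ne_zero hG0)]
    exact Polynomial.natDegree_le_of_dvd hP ((pfree G).isDistinguishedAt_weierstrassDistinguished (red_pfree_ne_zero hG0)).monic.ne_zero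
  exact mu_eq_zero_of_natCard_endInvariants_relNorm_lt W κ hγ D hD hchar (hlamle.trans_lt hhigh) hlt

end Datum

/-! ## §3 The C2 datum (`p = 2`): `#ker N_n < 2^{2ⁿ}` at one layer with `2ⁿ > λ_an` ⟹ `μ₂(X(W/ℚ_∞)) = 0` -/

section Two

variable (W : WeierstrassCurve ℚ) [W.IsGloballyMinimal]

/-- ★★★ **THE `μ`-RESIDUE OF C2 FROM ONE UPPER BOUND (`p = 2`).** `W/ℚ` globally minimal, ordinary at `2`; `f` a newform of `W`, `G ≠ 0` an integral lift of
`L₂(f, α)`; PRINT `h17`; a cyclotomic dual datum `D` with `X` finitely generated (finite submodules allowed), `char_Λ X = (f_X)`, `f_X ≠ 0`. If at ONE layer `n` with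
**`λ(G) < 2ⁿ`**: **`#ker(N_n | Sel_{2^∞}(W/ℚ_∞)) < 2^{2ⁿ}`** (`N_n = 1 + conj_γ^{2ⁿ}`), then **`μ(f_X) = 0` and `μ₂(X(W/ℚ_∞)) = 0`** — the open input of C2 for the
seed, from an INEQUALITY, WITHOUT the Prop. 4.14 binder of g54's exact form (`λ_an = 2`: `n = 2`, bound `16`; `λ_an = 4, 6`: `n = 3`, bound `256`).
[cite: Kato2004Asterisque, Thm. 17.4 (1)(2) (p. 273)] [cite: GreenbergLNM1716, Conj. 1.11 and p. 180] -/
theorem mu_eq_zero_of_kato_of_natCard_endInvariants_relNorm_lt_two {N : ℕ} [NeZero N] {f : CuspForm (Gamma0 N) 2}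
    (h17 : kato_divisibility_allPrimes W 2 (f := f)) {κ : ZpExtension ℚ 2} {γ : Field.absoluteGaloisGroup ℚ}
    (hκ : κ.IsCyclotomic) (hγ : κ.IsTopGenerator γ) (hγ' : IsCyclotomicVariable 2 γ) (hord : IsOrdinaryAt W 2) (hf : IsNewformOf W f)
    (D : W.SelmerDualData κ γ) [Module.Finite (IwasawaAlgebra 2) D.X]
    {fX : IwasawaAlgebra 2} (hfX : fX ≠ 0) (hchar : D.charIdeal = Ideal.span {fX}) {G : IwasawaAlgebra 2} (hG0 : G ≠ 0)
    (hG : iwasawaToPowerSeries 2 G = padicLFunction f (unitRoot W 2 : ℚ_[2])) {n : ℕ} (hhigh : lam G < 2 ^ n)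
    (hlt : Nat.card ↥(endInvariants (∑ i ∈ Finset.range 2, ((W.conjSelmerInfty κ γ) ^ (2 ^ n)) ^ i)) < 2 ^ (2 ^ n)) :
    mu fX = 0 ∧ D.mu = 0 := by
  have hhigh' : lam G < 2 ^ n * (2 - 1) := by rw [show (2:ℕ) - 1 = 1 from rfl, mul_one]; exact hhigh
  have hlt' : Nat.card ↥(endInvariants (∑ i ∈ Finset.range 2, ((W.conjSelmerInfty κ γ) ^ (2 ^ n)) ^ i)) < 2 ^ (2 ^ n * (2 - 1)) := by
    rw [show (2:ℕ) - 1 = 1 from rfl, mul_one]; exact hlt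
  exact mu_eq_zero_of_kato_of_natCard_endInvariants_relNorm_lt W 2 h17 hκ hγ hγ' hord hf D hfX hchar hG0 hG hhigh' hlt'

omit [W.IsGloballyMinimal] in
/-- **`p = 2` reading: the relative norm is `N_n = 1 + σ_n`, `σ_n = conj_γ^{2ⁿ}`, and its kernel is the MINUS eigenspace `{s : σ_n s = −s}`** of the limit Selmer
group — the descent number of the lineage at `2` is the order of a sign eigenspace (`∑_{i<2} c^i = 1 + c`). [cite: GreenbergLNM1716, §1 p. 65] -/
theorem endInvariants_relNorm_two_eq {κ : ZpExtension ℚ 2} {γ : Field.absoluteGaloisGroup ℚ} (n : ℕ) :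
    (endInvariants (∑ i ∈ Finset.range 2, ((W.conjSelmerInfty κ γ) ^ (2 ^ n)) ^ i) : Set ↥(W.selmerInfty κ)) =
      {s | ((W.conjSelmerInfty κ γ) ^ (2 ^ n)) s = -s} := by
  ext s
  rw [SetLike.mem_coe, mem_endInvariants_iff, Finset.sum_range_succ, Finset.sum_range_succ, Finset.sum_range_zero, zero_add, pow_zero, pow_one,
    Set.mem_setOf_eq]
  change s + ((W.conjSelmerInfty κ γ) ^ (2 ^ n)) s = 0 ↔ _
  rw [add_comm, add_eq_zero_iff_eq_neg]

end Two

end Summit.BirchSwinnertonDyer.BirchSwinnertonDyer.Theorems.AlignedTransportAtTwoHalfDescentLayerIndexFiniteSelmer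

end
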